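import Mathlib.RingTheory.Ideal.MinimalPrime.Noetherian
import Literature.Computability.AlgebraicComplexity.LS00TwoByTwoPermanentalIdealsMinimalPrimes
import HarnessLib

/-!
# Laubenbacher–Swanson 2000, Corollary 4.4: the number of minimal primes of `P₂(M)`
# (corrected; the printed case labels are swapped)

Topic `Literature/Computability/AlgebraicComplexity`; theorem-only file (no definitions, no named
facts), sibling of `LS00TwoByTwoPermanentalIdealsMinimalPrimes` (Thm. 4.1: the classification of the
minimal primes of the ideal `P₂(M)` of `2 × 2` permanents of the generic `m × n` matrix).  Source:
R. C. Laubenbacher, I. Swanson, *Permanental ideals*, J. Symbolic Comput. 30 (2000) 195–205,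
arXiv:math/9812112 (held; Corollary 4.4 = arXiv text p0006 L127–137).  `F` a field with `2 ≠ 0`.

## What is typed

* `cor_4_4` — **Corollary 4.4, CORRECTED**: for `m, n ≥ 2` the set of minimal primes of `P₂(M)` is
  finite of cardinality `[n ≥ 3]·m + [m ≥ 3]·n + C(m,2)·C(n,2)` — type (1) primes (the variables
  off one row) exist iff `n ≥ 3` and there are `m` of them, type (2) iff `m ≥ 3` with `n` of them,
  and the type (3) primes are indexed by the `2 × 2` blocks (Thm. 4.1 = the tree's `thm_4_1`; the
  three families are pairwise disjoint and injectively parametrised — variable membership,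
  `X_notMem_blockIdeal`).  Printed: "`m + n + C(m,2)C(n,2)` if `m, n ≥ 3`; `m + C(m,2)C(n,2)` if
  `m ≥ 3, n = 2`; `n + C(m,2)C(n,2)` if `m = 2, n ≥ 3`; `1` if `m = n = 2`" — the first and last
  bullets agree with the corrected count (`cor_4_4_of_three_le`, `cor_4_4_two_two`), the two middle
  bullets have their labels swapped: for `m ≥ 3, n = 2` the count is `n + C(m,2)C(n,2) = 2 + C(m,2)`
  (`cor_4_4_of_cols_two`), for `m = 2, n ≥ 3` it is `m + C(m,2)C(n,2) = 2 + C(n,2)`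
  (`cor_4_4_of_rows_two`); kernel witness `cor_4_4_asPrinted_counterexample`: at `(m, n) = (3, 2)`
  there are `5` minimal primes (two column primes and three blocks), not the printed `6`.  Typed ≠
  printed, flagged for the PRINT-ERRATA registry (Tier B side remark; arXiv text — the journal
  version was not compared); Thm. 4.1 / Rem. 4.2 / §5 are unaffected.
* `blockIdeal_eq_of_pair` — the type (3) ideal written on the unordered block `(R, C)`,
  `|R| = |C| = 2`, as `span (insert per[R|C] (X '' {x | ¬(x.1 ∈ R ∧ x.2 ∈ C)}))`, agrees with the
  sibling's `r, s, c, d` form.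

Honest framing: V0 dictionary (commutative algebra of `P₂(M)`); no rung of any route moves; VP ≠ VNP
is NOT proved.

## References

* R. C. Laubenbacher, I. Swanson, *Permanental ideals*, J. Symbolic Comput. 30 (2000) 195–205,
  arXiv:math/9812112: Cor. 4.4 (p0006 L127–137), Thm. 4.1 (p0006 L9–22). [LaubenbacherSwanson2000]
-/

noncomputable section

open Matrix MvPolynomial Finset

namespace Literature.Computability.AlgebraicComplexity

namespace LaubenbacherSwanson2000

open VonZurGathen BoraleviCarliniMichalekVentura2025

section Count

variable (F : Type*) [Field F] {m n : ℕ}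

/-- A variable lies in the ideal of the variables of `S` iff it is one of them. [folklore] -/
private theorem X_mem_span_X_image_iff' (S : Set (Fin m × Fin n)) (x : Fin m × Fin n) :
    (X x : MvPolynomial (Fin m × Fin n) F) ∈
      Ideal.span ((fun x => (X x : MvPolynomial (Fin m × Fin n) F)) '' S) ↔ x ∈ S := by
  classical
  constructor
  · intro h
    obtain ⟨z, hz, hzx⟩ := mem_ideal_span_X_image.1 h (Finsupp.single x 1)
      (by rw [support_X]; exact Finset.mem_singleton_self _)
    rw [Finsupp.single_apply] at hzx
    split_ifs at hzx with hz'
    · rw [hz']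
      exact hz
    · exact absurd rfl hzx
  · intro hx
    exact Ideal.subset_span ⟨x, hx, rfl⟩

/-- **The type (3) ideal on an unordered block** `(R, C)`, `R = {r, s}`, `C = {c, d}`: the span of
the subpermanent `per[R|C]` of the generic matrix and the variables off `R × C` is the sibling's
type (3) ideal of `(r, s; c, d)`. [cite: LaubenbacherSwanson2000, Thm. 4.1 (arXiv text p0006 L9–22)] -/
theorem blockIdeal_eq_of_pair {r s : Fin m} {c d : Fin n} (hrs : r ≠ s) (hcd : c ≠ d) :
    Ideal.span (insert (rsubperm (mvPolynomialX (Fin m) (Fin n) F) (· ∈ ({c, d} : Finset (Fin n)))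
        (· ∈ ({r, s} : Finset (Fin m))))
      ((fun x => (X x : MvPolynomial (Fin m × Fin n) F)) ''
        {x | ¬(x.1 ∈ ({r, s} : Finset (Fin m)) ∧ x.2 ∈ ({c, d} : Finset (Fin n)))})) =
    Ideal.span (insert (X (r, c) * X (s, d) + X (r, d) * X (s, c) :
        MvPolynomial (Fin m × Fin n) F)
      ((fun x => (X x : MvPolynomial (Fin m × Fin n) F)) ''
        {x | ¬((x.1 = r ∨ x.1 = s) ∧ (x.2 = c ∨ x.2 = d))})) := by
  rw [rsubperm_pair _ hrs hcd]
  simp only [Matrix.mvPolynomialX_apply, Finset.mem_insert, Finset.mem_singleton]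

/-- **Theorem 4.1 with the type (3) primes indexed by unordered blocks** `(R, C)`, `|R| = |C| = 2`.
[cite: LaubenbacherSwanson2000, Thm. 4.1 (arXiv text p0006 L9–22)] -/
theorem mem_minimalPrimes_iff_of_pair (h2 : (2 : F) ≠ 0) (hm : 2 ≤ m) (hn : 2 ≤ n)
    (Q : Ideal (MvPolynomial (Fin m × Fin n) F)) :
    Q ∈ (subpermIdeal F m n 2).minimalPrimes ↔
      (3 ≤ n ∧ ∃ r : Fin m,
        Q = Ideal.span ((fun x => (X x : MvPolynomial (Fin m × Fin n) F)) '' {x | x.1 ≠ r})) ∨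
      (3 ≤ m ∧ ∃ c : Fin n,
        Q = Ideal.span ((fun x => (X x : MvPolynomial (Fin m × Fin n) F)) '' {x | x.2 ≠ c})) ∨
      (∃ (R : Finset (Fin m)) (C : Finset (Fin n)), R.card = 2 ∧ C.card = 2 ∧
        Q = Ideal.span (insert (rsubperm (mvPolynomialX (Fin m) (Fin n) F) (· ∈ C) (· ∈ R))
          ((fun x => (X x : MvPolynomial (Fin m × Fin n) F)) '' {x | ¬(x.1 ∈ R ∧ x.2 ∈ C)}))) := by
  rw [thm_4_1 F h2 hm hn Q]
  refine or_congr Iff.rfl (or_congr Iff.rfl ⟨?_, ?_⟩)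
  · rintro ⟨r, s, c, d, hrs, hcd, rfl⟩
    exact ⟨{r, s}, {c, d}, Finset.card_pair hrs, Finset.card_pair hcd,
      (blockIdeal_eq_of_pair F hrs hcd).symm⟩
  · rintro ⟨R, C, hR, hC, rfl⟩
    obtain ⟨r, s, hrs, rfl⟩ := Finset.card_eq_two.1 hR
    obtain ⟨c, d, hcd, rfl⟩ := Finset.card_eq_two.1 hC
    exact ⟨r, s, c, d, hrs, hcd, blockIdeal_eq_of_pair F hrs hcd⟩

/-- A block variable is not in the type (3) ideal of the block (unordered form). [cite: LaubenbacherSwanson2000, Rem. 4.2 (arXiv text p0006 L106–108)] -/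
private theorem X_notMem_blockIdeal_pair {R : Finset (Fin m)} {C : Finset (Fin n)} (hR : R.card = 2)
    (hC : C.card = 2) {x : Fin m × Fin n} (hx : x.1 ∈ R ∧ x.2 ∈ C) :
    (X x : MvPolynomial (Fin m × Fin n) F) ∉
      Ideal.span (insert (rsubperm (mvPolynomialX (Fin m) (Fin n) F) (· ∈ C) (· ∈ R))
        ((fun x => (X x : MvPolynomial (Fin m × Fin n) F)) '' {x | ¬(x.1 ∈ R ∧ x.2 ∈ C)})) := by
  obtain ⟨r, s, hrs, rfl⟩ := Finset.card_eq_two.1 hR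
  obtain ⟨c, d, hcd, rfl⟩ := Finset.card_eq_two.1 hC
  rw [blockIdeal_eq_of_pair F hrs hcd]
  simp only [Finset.mem_insert, Finset.mem_singleton] at hx
  exact X_notMem_blockIdeal hrs hcd hx

/-- An off-block variable is in the type (3) ideal (unordered form). [cite: LaubenbacherSwanson2000, Thm. 4.1 (arXiv text p0006 L9–22)] -/
private theorem X_mem_blockIdeal_pair {R : Finset (Fin m)} {C : Finset (Fin n)} {x : Fin m × Fin n}
    (hx : ¬(x.1 ∈ R ∧ x.2 ∈ C)) :
    (X x : MvPolynomial (Fin m × Fin n) F) ∈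
      Ideal.span (insert (rsubperm (mvPolynomialX (Fin m) (Fin n) F) (· ∈ C) (· ∈ R))
        ((fun x => (X x : MvPolynomial (Fin m × Fin n) F)) '' {x | ¬(x.1 ∈ R ∧ x.2 ∈ C)})) :=
  Ideal.subset_span (Set.mem_insert_of_mem _ ⟨x, hx, rfl⟩)

/-- A finset of `Fin k` with fewer than `k` elements misses a point. [folklore] -/
private theorem exists_notMem_of_card_lt {k : ℕ} (S : Finset (Fin k)) (h : S.card < k) :
    ∃ a : Fin k, a ∉ S := by
  by_contra hall
  have hsub : (Finset.univ : Finset (Fin k)) ⊆ S := fun a _ => by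
    by_contra ha
    exact hall ⟨a, ha⟩
  have := Finset.card_le_card hsub
  rw [Finset.card_univ, Fintype.card_fin] at this
  omega

/-- The number of `2`-element subsets of `Fin k` is `C(k, 2)`. [folklore] -/
private theorem natCard_pairs (k : ℕ) : Nat.card {R : Finset (Fin k) // R.card = 2} = k.choose 2 := by
  classical
  rw [Nat.card_eq_fintype_card, Fintype.card_subtype, ← Finset.powerset_univ,
    ← Finset.powersetCard_eq_filter, Finset.card_powersetCard, Finset.card_univ, Fintype.card_fin]

/-- The set of minimal primes of `P₂(M)` is finite (Noetherian ring), so that its `ncard` below is an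
honest count. [cite: LaubenbacherSwanson2000, Cor. 4.4 (arXiv text p0006 L127–137)] -/
theorem finite_minimalPrimes : (subpermIdeal F m n 2).minimalPrimes.Finite :=
  Ideal.finite_minimalPrimes_of_isNoetherianRing _ _

/-- **Laubenbacher–Swanson 2000, Corollary 4.4 (the number of minimal components of `P₂(M)`),
CORRECTED** — over a field with `2 ≠ 0` and for `m, n ≥ 2`, `P₂(M)` has exactly
`[n ≥ 3]·m + [m ≥ 3]·n + C(m,2)·C(n,2)` minimal primes.  As printed (arXiv text p0006 L127–137):
"`m + n + C(m,2)C(n,2)` if `m, n ≥ 3`; `m + C(m,2)C(n,2)` if `m ≥ 3, n = 2`; `n + C(m,2)C(n,2)` if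
`m = 2, n ≥ 3`; `1` if `m = n = 2`" — the two middle labels are swapped (typed ≠ printed; see
`cor_4_4_asPrinted_counterexample`); the journal version J. Symbolic Comput. 30 (2000) was NOT
compared by the typer. [cite: LaubenbacherSwanson2000, Cor. 4.4 (arXiv:math/9812112 text p0006 L127–137)] -/
theorem cor_4_4 (h2 : (2 : F) ≠ 0) (hm : 2 ≤ m) (hn : 2 ≤ n) :
    (subpermIdeal F m n 2).minimalPrimes.ncard =
      (if 3 ≤ n then m else 0) + (if 3 ≤ m then n else 0) + m.choose 2 * n.choose 2 := by
  classical
  -- the three families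
  let Row : Fin m → Ideal (MvPolynomial (Fin m × Fin n) F) := fun r =>
    Ideal.span ((fun x => (X x : MvPolynomial (Fin m × Fin n) F)) '' {x | x.1 ≠ r})
  let Col : Fin n → Ideal (MvPolynomial (Fin m × Fin n) F) := fun c =>
    Ideal.span ((fun x => (X x : MvPolynomial (Fin m × Fin n) F)) '' {x | x.2 ≠ c})
  let Blk : {R : Finset (Fin m) // R.card = 2} × {C : Finset (Fin n) // C.card = 2} →
      Ideal (MvPolynomial (Fin m × Fin n) F) := fun p =>
    Ideal.span (insert (rsubperm (mvPolynomialX (Fin m) (Fin n) F) (· ∈ p.2.1) (· ∈ p.1.1))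
      ((fun x => (X x : MvPolynomial (Fin m × Fin n) F)) '' {x | ¬(x.1 ∈ p.1.1 ∧ x.2 ∈ p.2.1)}))
  -- variable membership tests
  have hRow : ∀ r x, (X x : MvPolynomial (Fin m × Fin n) F) ∈ Row r ↔ x.1 ≠ r := fun r x =>
    X_mem_span_X_image_iff' F _ x
  have hCol : ∀ c x, (X x : MvPolynomial (Fin m × Fin n) F) ∈ Col c ↔ x.2 ≠ c := fun c x =>
    X_mem_span_X_image_iff' F _ x
  have c0 : Fin n := ⟨0, by omega⟩
  have r0 : Fin m := ⟨0, by omega⟩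
  -- the classification as a set identity
  have hset : (subpermIdeal F m n 2).minimalPrimes =
      {Q | 3 ≤ n ∧ ∃ r, Q = Row r} ∪ {Q | 3 ≤ m ∧ ∃ c, Q = Col c} ∪ Set.range Blk := by
    ext Q
    rw [show Q ∈ (subpermIdeal F m n 2).minimalPrimes ↔ _ from
      mem_minimalPrimes_iff_of_pair F h2 hm hn Q]
    simp only [Set.mem_union, Set.mem_setOf_eq, Set.mem_range, Prod.exists, Subtype.exists,
      Blk]
    constructor
    · rintro (h | h | ⟨R, C, hR, hC, rfl⟩)
      · exact Or.inl (Or.inl h)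
      · exact Or.inl (Or.inr h)
      · exact Or.inr ⟨R, hR, C, hC, rfl⟩
    · rintro ((h | h) | ⟨R, hR, C, hC, rfl⟩)
      · exact Or.inl h
      · exact Or.inr (Or.inl h)
      · exact Or.inr (Or.inr ⟨R, C, hR, hC, rfl⟩)
  -- injectivity of the three parametrisations
  have hRow_inj : Function.Injective Row := by
    intro r r' h
    by_contra hne
    have h1 : (X (r', c0) : MvPolynomial (Fin m × Fin n) F) ∈ Row r := (hRow r _).2 (Ne.symm hne)
    rw [h] at h1
    exact (hRow r' _).1 h1 rfl
  have hCol_inj : Function.Injective Col := by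
    intro c c' h
    by_contra hne
    have h1 : (X (r0, c') : MvPolynomial (Fin m × Fin n) F) ∈ Col c := (hCol c _).2 (Ne.symm hne)
    rw [h] at h1
    exact (hCol c' _).1 h1 rfl
  have hBlk_inj : Function.Injective Blk := by
    rintro ⟨⟨R, hR⟩, ⟨C, hC⟩⟩ ⟨⟨R', hR'⟩, ⟨C', hC'⟩⟩ h
    simp only [Blk] at h
    by_contra hne
    have hne' : R ≠ R' ∨ C ≠ C' := by
      by_contra h'
      simp only [not_or, not_not] at h'
      obtain ⟨rfl, rfl⟩ := h'
      exact hne rfl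
    obtain ⟨c, hc⟩ : C.Nonempty := Finset.card_pos.1 (by omega)
    obtain ⟨r, hr⟩ : R.Nonempty := Finset.card_pos.1 (by omega)
    rcases hne' with hRR | hCC
    · -- a row of one block missing from the other
      have key : ∀ (R₁ R₂ : Finset (Fin m)) (C₁ C₂ : Finset (Fin n)), R₁.card = 2 → C₁.card = 2 →
          (∃ a ∈ R₁, a ∉ R₂) →
          Ideal.span (insert (rsubperm (mvPolynomialX (Fin m) (Fin n) F) (· ∈ C₁) (· ∈ R₁))
            ((fun x => (X x : MvPolynomial (Fin m × Fin n) F)) '' {x | ¬(x.1 ∈ R₁ ∧ x.2 ∈ C₁)})) ≠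
          Ideal.span (insert (rsubperm (mvPolynomialX (Fin m) (Fin n) F) (· ∈ C₂) (· ∈ R₂))
            ((fun x => (X x : MvPolynomial (Fin m × Fin n) F)) ''
              {x | ¬(x.1 ∈ R₂ ∧ x.2 ∈ C₂)})) := by
        intro R₁ R₂ C₁ C₂ hR₁ hC₁ ⟨a, ha, ha'⟩ heq
        obtain ⟨c₁, hc₁⟩ : C₁.Nonempty := Finset.card_pos.1 (by omega)
        have hin := X_notMem_blockIdeal_pair F hR₁ hC₁ (x := (a, c₁)) ⟨ha, hc₁⟩
        rw [heq] at hin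
        exact hin (X_mem_blockIdeal_pair F (fun h => ha' h.1))
      by_cases hsub : ∃ a ∈ R, a ∉ R'
      · exact key R R' C C' hR hC hsub h
      · have hsub' : ∃ a ∈ R', a ∉ R := by
          by_contra h'
          apply hRR
          apply Finset.eq_of_subset_of_card_le
          · intro a ha
            by_contra hna
            exact hsub ⟨a, ha, hna⟩
          · rw [hR, hR']
        exact key R' R C' C hR' hC' hsub' h.symm
    · have key : ∀ (R₁ R₂ : Finset (Fin m)) (C₁ C₂ : Finset (Fin n)), R₁.card = 2 → C₁.card = 2 →
          (∃ a ∈ C₁, a ∉ C₂) →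
          Ideal.span (insert (rsubperm (mvPolynomialX (Fin m) (Fin n) F) (· ∈ C₁) (· ∈ R₁))
            ((fun x => (X x : MvPolynomial (Fin m × Fin n) F)) '' {x | ¬(x.1 ∈ R₁ ∧ x.2 ∈ C₁)})) ≠
          Ideal.span (insert (rsubperm (mvPolynomialX (Fin m) (Fin n) F) (· ∈ C₂) (· ∈ R₂))
            ((fun x => (X x : MvPolynomial (Fin m × Fin n) F)) ''
              {x | ¬(x.1 ∈ R₂ ∧ x.2 ∈ C₂)})) := by
        intro R₁ R₂ C₁ C₂ hR₁ hC₁ ⟨a, ha, ha'⟩ heq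
        obtain ⟨r₁, hr₁⟩ : R₁.Nonempty := Finset.card_pos.1 (by omega)
        have hin := X_notMem_blockIdeal_pair F hR₁ hC₁ (x := (r₁, a)) ⟨hr₁, ha⟩
        rw [heq] at hin
        exact hin (X_mem_blockIdeal_pair F (fun h => ha' h.2))
      by_cases hsub : ∃ a ∈ C, a ∉ C'
      · exact key R R' C C' hR hC hsub h
      · have hsub' : ∃ a ∈ C', a ∉ C := by
          by_contra h'
          apply hCC
          apply Finset.eq_of_subset_of_card_le
          · intro a ha
            by_contra hna
            exact hsub ⟨a, ha, hna⟩
          · rw [hC, hC']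
        exact key R' R C' C hR' hC' hsub' h.symm
  -- pairwise disjointness of the three families
  have hRC : Disjoint {Q | 3 ≤ n ∧ ∃ r, Q = Row r} {Q | 3 ≤ m ∧ ∃ c, Q = Col c} := by
    rw [Set.disjoint_left]
    rintro Q ⟨-, r, rfl⟩ ⟨-, c, hc⟩
    obtain ⟨c', hc'⟩ : ∃ c' : Fin n, c' ≠ c := by
      by_cases h0 : c.val = 0
      · exact ⟨⟨1, by omega⟩, fun e => by simp only [Fin.ext_iff] at e; omega⟩
      · exact ⟨⟨0, by omega⟩, fun e => by simp only [Fin.ext_iff] at e; omega⟩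
    have h1 : (X (r, c') : MvPolynomial (Fin m × Fin n) F) ∈ Col c := (hCol c _).2 hc'
    rw [← hc] at h1
    exact (hRow r _).1 h1 rfl
  have hRB : Disjoint ({Q | 3 ≤ n ∧ ∃ r, Q = Row r} ∪ {Q | 3 ≤ m ∧ ∃ c, Q = Col c})
      (Set.range Blk) := by
    rw [Set.disjoint_left]
    rintro Q (⟨hn3, r, rfl⟩ | ⟨hm3, c, rfl⟩) ⟨⟨⟨R, hR⟩, ⟨C, hC⟩⟩, hQ⟩
    · -- a column off `C`
      obtain ⟨c', hc'⟩ := exists_notMem_of_card_lt C (by omega)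
      have h1 : (X (r, c') : MvPolynomial (Fin m × Fin n) F) ∈ Blk ⟨⟨R, hR⟩, ⟨C, hC⟩⟩ :=
        X_mem_blockIdeal_pair F (fun h => hc' h.2)
      rw [hQ] at h1
      exact (hRow r _).1 h1 rfl
    · obtain ⟨r', hr'⟩ := exists_notMem_of_card_lt R (by omega)
      have h1 : (X (r', c) : MvPolynomial (Fin m × Fin n) F) ∈ Blk ⟨⟨R, hR⟩, ⟨C, hC⟩⟩ :=
        X_mem_blockIdeal_pair F (fun h => hr' h.1)
      rw [hQ] at h1
      exact (hCol c _).1 h1 rfl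
  -- the cardinalities of the three families
  have hfinR : ({Q | 3 ≤ n ∧ ∃ r, Q = Row r} : Set _).Finite :=
    (Set.finite_range Row).subset (by rintro Q ⟨-, r, rfl⟩; exact ⟨r, rfl⟩)
  have hfinC : ({Q | 3 ≤ m ∧ ∃ c, Q = Col c} : Set _).Finite :=
    (Set.finite_range Col).subset (by rintro Q ⟨-, c, rfl⟩; exact ⟨c, rfl⟩)
  have hcardR : ({Q | 3 ≤ n ∧ ∃ r, Q = Row r} : Set _).ncard = if 3 ≤ n then m else 0 := by
    split_ifs with h3
    · have : ({Q | 3 ≤ n ∧ ∃ r, Q = Row r} : Set _) = Set.range Row := by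
        ext Q
        simp only [Set.mem_setOf_eq, Set.mem_range, h3, true_and, eq_comm]
      rw [this, Set.ncard_range_of_injective hRow_inj, Nat.card_eq_fintype_card, Fintype.card_fin]
    · have : ({Q | 3 ≤ n ∧ ∃ r, Q = Row r} : Set _) = ∅ := by
        ext Q
        simp only [Set.mem_setOf_eq, h3, false_and, Set.mem_empty_iff_false]
      rw [this, Set.ncard_empty]
  have hcardC : ({Q | 3 ≤ m ∧ ∃ c, Q = Col c} : Set _).ncard = if 3 ≤ m then n else 0 := by
    split_ifs with h3
    · have : ({Q | 3 ≤ m ∧ ∃ c, Q = Col c} : Set _) = Set.range Col := by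
        ext Q
        simp only [Set.mem_setOf_eq, Set.mem_range, h3, true_and, eq_comm]
      rw [this, Set.ncard_range_of_injective hCol_inj, Nat.card_eq_fintype_card, Fintype.card_fin]
    · have : ({Q | 3 ≤ m ∧ ∃ c, Q = Col c} : Set _) = ∅ := by
        ext Q
        simp only [Set.mem_setOf_eq, h3, false_and, Set.mem_empty_iff_false]
      rw [this, Set.ncard_empty]
  have hcardB : (Set.range Blk).ncard = m.choose 2 * n.choose 2 := by
    rw [Set.ncard_range_of_injective hBlk_inj, Nat.card_prod, natCard_pairs, natCard_pairs]
  rw [hset, Set.ncard_union_eq hRB (hfinR.union hfinC) (Set.finite_range Blk),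
    Set.ncard_union_eq hRC hfinR hfinC, hcardR, hcardC, hcardB]

/-- **Corollary 4.4, first bullet as printed**: for `m, n ≥ 3` there are `m + n + C(m,2)C(n,2)`
minimal primes. [cite: LaubenbacherSwanson2000, Cor. 4.4 (arXiv text p0006 L127–131)] -/
theorem cor_4_4_of_three_le (h2 : (2 : F) ≠ 0) (hm : 3 ≤ m) (hn : 3 ≤ n) :
    (subpermIdeal F m n 2).minimalPrimes.ncard = m + n + m.choose 2 * n.choose 2 := by
  rw [cor_4_4 F h2 (by omega) (by omega), if_pos hn, if_pos hm]

/-- **Corollary 4.4, case `m ≥ 3, n = 2`, CORRECTED**: `2 + C(m,2)` minimal primes (the two column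
primes and the `C(m,2)` blocks); the print says `m + C(m,2)C(n,2)` here.
[cite: LaubenbacherSwanson2000, Cor. 4.4 (arXiv text p0006 L127–137)] -/
theorem cor_4_4_of_cols_two (h2 : (2 : F) ≠ 0) (hm : 3 ≤ m) :
    (subpermIdeal F m 2 2).minimalPrimes.ncard = 2 + m.choose 2 := by
  rw [cor_4_4 F h2 (by omega) le_rfl, if_neg (by omega), if_pos hm, Nat.choose_self, mul_one,
    zero_add]

/-- **Corollary 4.4, case `m = 2, n ≥ 3`, CORRECTED**: `2 + C(n,2)` minimal primes (the two row
primes and the `C(n,2)` blocks); the print says `n + C(m,2)C(n,2)` here.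
[cite: LaubenbacherSwanson2000, Cor. 4.4 (arXiv text p0006 L127–137)] -/
theorem cor_4_4_of_rows_two (h2 : (2 : F) ≠ 0) (hn : 3 ≤ n) :
    (subpermIdeal F 2 n 2).minimalPrimes.ncard = 2 + n.choose 2 := by
  rw [cor_4_4 F h2 le_rfl (by omega), if_pos hn, if_neg (by omega), Nat.choose_self, one_mul,
    add_zero]

/-- **Corollary 4.4, last bullet as printed**: for `m = n = 2`, `P₂(M)` has exactly one minimal
prime (it is prime). [cite: LaubenbacherSwanson2000, Cor. 4.4 (arXiv text p0006 L127–137)] -/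
theorem cor_4_4_two_two (h2 : (2 : F) ≠ 0) :
    (subpermIdeal F 2 2 2).minimalPrimes.ncard = 1 := by
  rw [cor_4_4 F h2 le_rfl le_rfl, if_neg (by omega), Nat.choose_self]

/-- **Corollary 4.4 at `(m, n) = (3, 3)`** (sanity instance of the first bullet):
`3 + 3 + C(3,2)·C(3,2) = 15` minimal primes. [cite: LaubenbacherSwanson2000, Cor. 4.4 (arXiv text p0006 L127–131)] -/
theorem cor_4_4_three_three (h2 : (2 : F) ≠ 0) :
    (subpermIdeal F 3 3 2).minimalPrimes.ncard = 15 := by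
  rw [cor_4_4_of_three_le F h2 le_rfl le_rfl]
  decide

/-- **Corollary 4.4 at `(m, n) = (2, 3)`**: `5` minimal primes (the two row primes of height `3` and the
three blocks of height `3` — cf. `cor_4_3_asPrinted_counterexample`); the printed third bullet
evaluates to `n + C(m,2)C(n,2) = 3 + 1·3 = 6` here. [cite: LaubenbacherSwanson2000, Cor. 4.4 (arXiv text p0006 L127–137)] -/
theorem cor_4_4_two_three (h2 : (2 : F) ≠ 0) :
    (subpermIdeal F 2 3 2).minimalPrimes.ncard = 5 ∧ 3 + Nat.choose 2 2 * Nat.choose 3 2 = 6 := by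
  rw [cor_4_4_of_rows_two F h2 le_rfl]
  decide

/-- **Kernel witness that Corollary 4.4 as printed mislabels its middle cases**: at
`(m, n) = (3, 2)` the set of minimal primes of `P₂(M)` has `5` elements (the two column primes
`(x₁₁, x₂₁, x₃₁)`, `(x₁₂, x₂₂, x₃₂)` and the three blocks), while the printed second bullet
"`m + C(m,2)C(n,2)` if `m ≥ 3, n = 2`" evaluates to `3 + 3·1 = 6`.
[cite: LaubenbacherSwanson2000, Cor. 4.4 (arXiv:math/9812112 text p0006 L127–137)] -/
theorem cor_4_4_asPrinted_counterexample (h2 : (2 : F) ≠ 0) :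
    (subpermIdeal F 3 2 2).minimalPrimes.ncard = 5 ∧ 3 + Nat.choose 3 2 * Nat.choose 2 2 = 6 := by
  rw [cor_4_4_of_cols_two F h2 le_rfl]
  decide

end Count

end LaubenbacherSwanson2000

end Literature.Computability.AlgebraicComplexity
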